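import Summits.Ventures.PercRepro.S1ChainRestrict

/-!
# PercRepro — THE PAIRWISE NULLITY BUDGET OF TWO PARTS (p2, gen 23; SUBCLAIM-S1 §6.8 (vi))

On a coloop-free core of nullity `d`, two parts `S`, `T` whose union is a proper subset satisfy
`ν(S) + ν(T) ≤ d − 1 + ν(S ∩ T)` (supermodularity of the nullity and the proper-subset bound of S1ChainRestrict).
For two rank-`4` flats with `≥ 5` points the intersection is a flat of rank `≤ 3` (`≤ 6` points, nullity `≤ 3`), so
two `8`-point rank-`4` flats cannot coexist at `d = 5`, a `U_{4,7}`-flat (nullity `3`, `21` five-circuits) leaves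
nullity `≤ 1` to every other rank-`4` flat at `d = 5` — the budget behind the joint caps of rows 8–10.

* **`nullity_add_nullity_le_of_union_ssubset`** — the pairwise budget, with the nullities as `r(S) + a ≤ |S|`,
  `r(T) + b ≤ |T|` and the intersection's nullity as `|S ∩ T| ≤ r(S ∩ T) + c`.
Axioms: standard.
-/

open scoped Matroid

namespace PercRepro

namespace S1

open Set

variable {α : Type}

/-- **The pairwise nullity budget**: on a coloop-free core with `|E| = r(E) + d`, for `S, T ⊆ E` with `S ∪ T ≠ E`,
`r(S) + a ≤ |S|`, `r(T) + b ≤ |T|` and `|S ∩ T| ≤ r(S ∩ T) + c`: `a + b ≤ d − 1 + c`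
(`ν(S ∪ T) ≥ ν(S) + ν(T) − ν(S ∩ T)` and `ν(S ∪ T) ≤ d − 1`). -/
theorem nullity_add_nullity_le_of_union_ssubset (M : Matroid α) [M.Finite] (hcol : M.coloops = ∅)
    {d : ℕ} (hd : M.E.encard = M.eRank + d) {S T : Set α} (hS : S ⊆ M.E) (hT : T ⊆ M.E) (hne : S ∪ T ≠ M.E)
    {a b c : ℕ} (ha : M.eRk S + (a : ℕ∞) ≤ (S.ncard : ℕ∞)) (hb : M.eRk T + (b : ℕ∞) ≤ (T.ncard : ℕ∞))
    (hc : ((S ∩ T).ncard : ℕ∞) ≤ M.eRk (S ∩ T) + (c : ℕ∞)) : a + b ≤ d - 1 + c := by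
  have hEfin : M.E.Finite := M.ground_finite
  have hSfin : S.Finite := hEfin.subset hS
  have hTfin : T.Finite := hEfin.subset hT
  have hsub := M.eRk_inter_add_eRk_union_le S T
  -- to naturals
  have hfin : ∀ X ⊆ M.E, M.eRk X ≠ ⊤ := fun X hX =>
    ((M.eRk_le_encard X).trans_lt (hEfin.subset hX).encard_lt_top).ne
  obtain ⟨rS, hrS⟩ := ENat.ne_top_iff_exists.1 (hfin S hS)
  obtain ⟨rT, hrT⟩ := ENat.ne_top_iff_exists.1 (hfin T hT)
  obtain ⟨rI, hrI⟩ := ENat.ne_top_iff_exists.1 (hfin (S ∩ T) (Set.inter_subset_left.trans hS))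
  obtain ⟨rU, hrU⟩ := ENat.ne_top_iff_exists.1 (hfin (S ∪ T) (Set.union_subset hS hT))
  rw [← hrI, ← hrU, ← hrS, ← hrT] at hsub
  rw [← hrS] at ha
  rw [← hrT] at hb
  rw [← hrI] at hc
  have hsub' : rI + rU ≤ rS + rT := by exact_mod_cast hsub
  have ha' : rS + a ≤ S.ncard := by exact_mod_cast ha
  have hb' : rT + b ≤ T.ncard := by exact_mod_cast hb
  have hc' : (S ∩ T).ncard ≤ rI + c := by exact_mod_cast hc
  have hcard := Set.ncard_union_add_ncard_inter S T hSfin hTfin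
  -- the union has nullity `≥ a + b − c`, and `≤ d − 1`
  have hrUle : rU ≤ (S ∪ T).ncard := by
    have h := M.eRk_le_encard (S ∪ T)
    rw [← hrU, ← (hSfin.union hTfin).cast_ncard_eq] at h
    exact_mod_cast h
  have hνU : M.eRk (S ∪ T) + ((a + b - c : ℕ) : ℕ∞) ≤ ((S ∪ T).ncard : ℕ∞) := by
    rw [← hrU]
    have : rU + (a + b - c) ≤ (S ∪ T).ncard := by omega
    exact_mod_cast this
  have h := nullity_add_one_le_of_ssubset_of_coloops_empty M hcol hd (Set.union_subset hS hT) hne hνU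
  omega

end S1

end PercRepro
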